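import Literature.Probability.Percolation.QuadCrossingContinuityReduction
import Literature.Probability.Percolation.QuadCrossingRawClosed
import Literature.Probability.Percolation.QuadCrossingSubquadTopology
import Literature.Probability.Percolation.QuadCrossingSubquadArm
import Literature.Probability.Percolation.AnnulusCrossingBoundProofs
import HarnessLib

/-!
# Schramm–Smirnov's Lemma 6.1, case (2) with `d₁ ≤ δ`: the crossing events differ with small probability

Topic `Probability/Percolation`; proofs file towards the named fact `SchrammSmirnov2011_lemma_6_1`
(`QuadCrossingContinuity.lean`; O. Schramm, S. Smirnov, *On the scaling limits of planar
percolation*, Ann. Probab. 39 (2011), arXiv:1101.5820, §6).  The printed proof of case (2) treats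
three sub-cases, `(i) d = d₁`, `(ii) d = d₀ > δ ≥ d₁`, `(iii) d = d₀ > d₁ > δ` (p. 22); sub-case
(ii) needs no lowest crossing: "we use the estimate (6.1):
`P(⊞_{Q'} ∖ ⊞_Q) ≤ P(⊞_{Q'}) ≤ Δ₁(d₁ + δ, (d₀ - δ)/2) ≤ Δ₁(2δ, d/4)`" (eq. (6.3)), where (6.1) is the
a-priori bound "any crossing of `Q'` … crosses an annulus `A(x, d₁ + δ, (d₀ - δ)/2)`" and `Δ₁` is
the RSW one-arm bound of Assumption 1.1 (1).  This file proves **sub-case (ii) for critical bond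
percolation on `δℤ²`, end to end**, from the tree's pieces:

* `⊞_Q ⊆ ⊞_{Q'}` for the discrete configuration (`Quad.exists_isCrossing_subquad_of_isCrossing`,
  `QuadCrossingSubquadTopology.lean`), so `⊞_Q Δ ⊞_{Q'} = ⊞_{Q'} ∖ ⊞_Q ⊆ ⊞_{Q'}`;
* the a-priori arm `Quad.mem_annulusOpenCrossing_of_isCrossing_inner` (`QuadCrossingSubquadArm.lean`)
  around the foot of a transversal `τ` of diameter `< 2 d₁ ≤ 2δ`;
* the RSW bound `annulusOpenCrossing_half_le_holds` (`AnnulusCrossingBoundProofs.lean`,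
  Grimmett 1999 §11.8 / Bollobás–Riordan 2006 Ch. 7 L. 4): `P_{1/2}(A(x; r, R)) ≤ (r/R)^α`;
* the reductions of `QuadCrossingContinuityReduction.lean` (`μ_η(⊞_Q Δ ⊞_{Q'}) ≤ P_{1/2}(…)`) and
  `QuadCrossingRawClosed.lean` (`Q ∈ ω_δ ↔` a crossing inside the open edges).

Result (`real_symmDiff_crossedEvent_le_of_isPerturbationTwo_of_sideDist_one_le`): there are
`α, C, c > 0` such that for all `D`, all quads `Q, Q'` of `D` and all `0 < ρ ≤ c · d₀(Q)` with
`Q.IsPerturbationTwo Q' ρ` and `d₁(Q) ≤ ρ`, and all meshes `0 < η < ρ`,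
`μ_η(⊞_Q Δ ⊞_{Q'}) ≤ (C ρ / d₀(Q))^α`.  (The perturbation size of the source's statement is `ρ` here;
`η` is the mesh of `squareCrossingLaw`, i.e. edges of length `η√2`.)

## References

* O. Schramm, S. Smirnov, Ann. Probab. 39 (2011) 1768–1814, arXiv:1101.5820, proof of Lemma 6.1,
  case (2), eqs. (6.1), (6.3). [SchrammSmirnov2011]
* G. Grimmett, *Percolation*, 2nd ed. (1999), §11.8. [GrimmettPercolation1999]
-/

noncomputable section

open scoped unitInterval
open Set Filter Metric Function MeasureTheory
open _root_.Topology
open Literature.Probability.LatticeModels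

namespace Literature.Probability.Percolation

namespace QuadCrossing

variable {D : Set ℂ}

/-- The annulus-crossing event grows with the inner radius. [folklore] -/
theorem annulusOpenCrossing_mono_left (x : ℂ) (δ : ℝ) {r r' : ℝ} (h : r ≤ r') (R : ℝ) :
    annulusOpenCrossing x δ r R ⊆ annulusOpenCrossing x δ r' R := fun ω hω => by
  obtain ⟨u, hu, w, hw, hconn⟩ := mem_annulusOpenCrossing_iff.1 hω
  exact mem_annulusOpenCrossing_iff.2 ⟨u, hu.trans h, w, hw, hconn⟩

/-- A transversal of `Q` from `∂₁Q` to `∂₃Q` of diameter `< 2 d₁(Q)` (the infimum `d₁(Q) > 0` is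
approached). [cite: SchrammSmirnov2011, Lemma 6.1] -/
theorem Quad.exists_transversal_diam_lt (Q : Quad D) :
    ∃ x₁ ∈ Q.side 1, ∃ x₃ ∈ Q.side 3, ∃ τ : Path x₁ x₃, range τ ⊆ Q.carrier ∧
      Metric.diam (range τ) < 2 * Q.sideDist 1 := by
  have hpos := Q.sideDist_pos 1
  have hlt : Q.sideDist 1 < 2 * Q.sideDist 1 := by linarith
  rw [Q.sideDist_eq 1] at hlt
  obtain ⟨r, ⟨x, hx, y, hy, τ, hτ, rfl⟩, hr⟩ := exists_lt_of_csInf_lt (Q.nonempty_sideDistSet 1) hlt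
  rw [← Q.sideDist_eq 1] at hr
  exact ⟨x, hx, y, hy, τ, hτ, hr⟩

/-- **Lemma 6.1, case (2), sub-case `d₁ ≤ ρ`** (Schramm–Smirnov's (ii), eq. (6.3)), for critical
bond percolation on `δℤ²`: there are `α, C, c > 0` such that whenever `Q.IsPerturbationTwo Q' ρ`,
`0 < ρ ≤ c · d₀(Q)` and `d₁(Q) ≤ ρ`, then for every mesh `0 < η < ρ`,
`μ_η(⊞_Q Δ ⊞_{Q'}) ≤ (C ρ / d₀(Q))^α`.  Proof: `⊞_Q ⊆ ⊞_{Q'}`; a crossing of `Q'` crosses the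
annulus `A(x₁; 3ρ + δ', d₀/16 - δ')` around the foot `x₁` of a transversal of diameter `< 2ρ`
(`δ' = η√2` the edge length); RSW. [cite: SchrammSmirnov2011, proof of Lemma 6.1, case (2) (ii), eq. (6.3)] -/
theorem real_symmDiff_crossedEvent_le_of_isPerturbationTwo_of_sideDist_one_le :
    ∃ α C c : ℝ, 0 < α ∧ 0 < C ∧ 0 < c ∧
      ∀ (D : Set ℂ) (Q Q' : Quad D) (ρ : ℝ), 0 < ρ → ρ ≤ c * Q.sideDist 0 →
        Q.IsPerturbationTwo Q' ρ → Q.sideDist 1 ≤ ρ →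
          ∀ η : ℝ, 0 < η → η < ρ →
            (squareCrossingLaw D η : Measure (QuadConfig D)).real
                (symmDiff (QuadConfig.crossedEvent Q) (QuadConfig.crossedEvent Q')) ≤
              (C * ρ / Q.sideDist 0) ^ α := by
  obtain ⟨α, c₀, hα, hc₀, hRSW⟩ := annulusOpenCrossing_half_le_holds
  set C₁ : ℝ := 5 + 2 * c₀ with hC₁
  have hC₁pos : 0 < C₁ := by rw [hC₁]; linarith
  refine ⟨α, 32 * C₁, 1 / (32 * (C₁ + 1)), hα, by positivity, by positivity, ?_⟩
  intro D Q Q' ρ hρ hρc h2 hd1 η hη hηρ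
  obtain ⟨hcar, h0, h1, h3, hjoin⟩ := h2
  set d₀ := Q.sideDist 0 with hd₀
  have hd₀pos : 0 < d₀ := Q.sideDist_pos 0
  -- the regime: `ρ ≤ d₀ / (32 (C₁ + 1))`
  have hρd : 32 * (C₁ + 1) * ρ ≤ d₀ := by
    have := hρc
    rw [div_mul_eq_mul_div, one_mul, le_div_iff₀ (by positivity)] at this
    linarith
  -- the mesh `δ' = η √2 < 2ρ`
  set δ' : ℝ := η * Real.sqrt 2 with hδ'
  have hδ'pos : 0 < δ' := mul_pos hη (Real.sqrt_pos.2 (by norm_num))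
  have hsqrt2 : Real.sqrt 2 < 2 := by
    rw [show (2 : ℝ) = Real.sqrt 4 by rw [show (4 : ℝ) = 2 ^ 2 by norm_num, Real.sqrt_sq (by norm_num)]]
    exact Real.sqrt_lt_sqrt (by norm_num) (by norm_num)
  have hδ'ρ : δ' < 2 * ρ := by
    calc δ' = η * Real.sqrt 2 := rfl
      _ < ρ * 2 := mul_lt_mul'' hηρ hsqrt2 hη.le (Real.sqrt_nonneg _)
      _ = 2 * ρ := by ring
  -- Step 1: the law is bounded by the `P_{1/2}`-probability of the symmetric difference
  refine (real_squareCrossingLaw_symmDiff_le D η Q Q').trans ?_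
  -- Step 2: the discrete events; `⊞_Q ⊆ ⊞_{Q'}`, so the symmetric difference is inside `⊞_{Q'}`
  set A : Set (BondConfig (Site 2)) := {ω | Q ∈ z2QuadConfig D δ' ω} with hA
  set B : Set (BondConfig (Site 2)) := {ω | Q' ∈ z2QuadConfig D δ' ω} with hB
  have hAB : A ⊆ B := fun ω hω => by
    rw [hA, mem_setOf_eq, mem_z2QuadConfig_iff_exists_isCrossing hδ'pos] at hω
    obtain ⟨K, hK, hKO⟩ := hω
    obtain ⟨K', hK', hK'O⟩ := Quad.exists_isCrossing_subquad_of_isCrossing hcar h0 h1 h3 hδ'pos hK hKO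
    rw [hB, mem_setOf_eq, mem_z2QuadConfig_iff_exists_isCrossing hδ'pos]
    exact ⟨K', hK', hK'O⟩
  have hsymm : symmDiff A B ⊆ B := by
    intro ω hω
    rcases (Set.mem_symmDiff).1 hω with ⟨hωA, -⟩ | ⟨hωB, -⟩
    · exact hAB hωA
    · exact hωB
  -- Step 3: a crossing of `Q'` crosses an annulus around the foot of a short transversal
  obtain ⟨x₁, hx₁, x₃, hx₃, τ, hτ, hτdiam⟩ := Q.exists_transversal_diam_lt
  have hD₁ : Metric.diam (range τ) ≤ 2 * ρ := by linarith
  set R : ℝ := d₀ / 16 with hR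
  have hDR : 2 * ρ + ρ < R := by rw [hR]; nlinarith
  have hR2 : 2 * R < Q.sideDist 0 - ρ := by rw [hR]; nlinarith
  set r'' : ℝ := max (2 * ρ + ρ + δ') (c₀ * δ') with hr''
  have hBE : B ⊆ annulusOpenCrossing x₁ δ' r'' (R - δ') := fun ω hω => by
    rw [hB, mem_setOf_eq, mem_z2QuadConfig_iff_exists_isCrossing hδ'pos] at hω
    obtain ⟨K, hK, hKO⟩ := hω
    exact annulusOpenCrossing_mono_left x₁ δ' (le_max_left _ _) _
      (Quad.mem_annulusOpenCrossing_of_isCrossing_inner hδ'pos hρ.le hcar h0 hjoin hx₁ hx₃ τ hτ hD₁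
        hDR hR2 hK hKO)
  -- Step 4: RSW
  have hr''δ : c₀ * δ' ≤ r'' := le_max_right _ _
  have hr''le : r'' ≤ C₁ * ρ := by
    rw [hr'', max_le_iff, hC₁]
    constructor
    · nlinarith
    · nlinarith [hc₀]
  have hR'ge : d₀ / 32 ≤ R - δ' := by rw [hR]; nlinarith
  have h2r : 2 * r'' ≤ R - δ' := by nlinarith
  have hRSW' := hRSW x₁ δ' r'' (R - δ') hδ'pos hr''δ h2r
  -- Step 5: assemble
  have hmono : (bondPercolation (zdGraph 2) half).real (symmDiff A B) ≤
      (bondPercolation (zdGraph 2) half).real (annulusOpenCrossing x₁ δ' r'' (R - δ')) :=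
    measureReal_mono (hsymm.trans hBE) (measure_ne_top _ _)
  refine hmono.trans (hRSW'.trans ?_)
  -- `(r''/(R - δ'))^α ≤ (32 C₁ ρ / d₀)^α`
  have hbase : r'' / (R - δ') ≤ 32 * C₁ * ρ / d₀ := by
    rw [div_le_div_iff₀ (by linarith) hd₀pos]
    calc r'' * d₀ ≤ C₁ * ρ * d₀ := by nlinarith
      _ = 32 * C₁ * ρ * (d₀ / 32) := by ring
      _ ≤ 32 * C₁ * ρ * (R - δ') := by
          apply mul_le_mul_of_nonneg_left hR'ge; positivity
  have hr''nn : 0 ≤ r'' / (R - δ') := div_nonneg (le_trans (by positivity) hr''δ) (by linarith)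
  exact Real.rpow_le_rpow hr''nn hbase hα.le

end QuadCrossing

end Literature.Probability.Percolation
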